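import Mathlib.Analysis.Complex.Schwarz
import HarnessLib

/-!
# THE CAUCHY SHAPE OF THE BACKGROUND FORM'S MODULI: Lipschitz `2B∕ρ` and discrete-C¹·¹ `16B∕ρ²` from a bounded analytic extension (abstract, Mathlib-only)

Cell `ym3-torus` (YM ladder rung R3 = continuum `SU(2)` Yang–Mills on the three-torus — a RUNG, NOT d = 4, NOT infinite volume, NOT a mass gap, NOT Clay).  Width seat
`ym-ust-20520-w5` (gen 20); `--supports stmt-QuantumFields-20520 --as helper`, count-neutral, definition-free, default heartbeats, Mathlib-only imports.

WHAT.  Ideator `ym-r3-idea-1` g24's LINE g24-4 «background_form» (`Cruxes/FluctuationComparisonRegPrIntL/Lines/background_form.lean`; junctions lifted into `Theorems/` by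
LEAD w3-20520 g20's (H) `…BackgroundFormAlgebra` ∕ `…BackgroundFormKnit`) reduces the PATH-B organ S2β `FluctuationPartSmall` to ONE row BGFORM∘ whose terms `T X` are
LIPSCHITZ (modulus `ℓ X`: `|T X u − T X u′| ≤ ℓ X · Σ_{e∈X} ‖u e − u′ e‖`) and DISCRETE-C¹·¹ (modulus `h X`:
`|T X u₁₁ − T X u₁₀ − T X u₀₁ + T X u₀₀| ≤ h X·(Σ‖u₁₀−u₀₀‖)(Σ‖u₀₁−u₀₀‖) + ℓ X·Σ‖u₁₁−u₁₀−u₀₁+u₀₀‖`) in the background variables, and whose background map has a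
PRODUCT-kernel mixed response.  The card's WHY-FAIL list prices these as (c) «moduli = (0.25) + analyticity (1.11)–(1.14) + Cauchy — a corollary» and (f) «the
product-kernel shape of the mixed response is the natural Cauchy-estimate shape but is not printed».  THIS FILE makes (c) and (f) kernel statements in the abstract:
for a function `𝒯 : V → ℂ` on a complex normed space `V`, complex-differentiable on a set `D` and bounded by `B` there,
* §1 ★ `norm_mixedDiff_le_of_differentiableOn_ball₂` — the TWO-PARAMETER SCHWARZ COROLLARY for `g : ℂ → ℂ → ℂ`: slices `g · 0`, `g · 1` differentiable on
  `ball 0 R₁`, every `g z ·` (`z ∈ ball 0 R₁`) differentiable on `ball 0 R₂`, `1 < Rᵢ`, `‖g z w‖ ≤ B` ⟹ `‖g 1 1 − g 1 0 − g 0 1 + g 0 0‖ ≤ 4B∕(R₁R₂)` (Mathlib's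
  `Complex.dist_le_div_mul_dist_of_mapsTo_ball` in `w` on each slice, then in `z` on the difference of the slices) — the second-order twin of LEAD's
  ✓`…PolymerAnalyticKnit.norm_sub_le_of_differentiableOn_ball` (`‖g 1 − g 0‖ ≤ 2B∕R`); `…_ball₂'` the symmetric form;
* §2 ★★ the AFFINE editions: `norm_sub_le_of_differentiableOn_affine` (`a + z•v ∈ D` for `‖z‖ < R` ⟹ `‖𝒯(a+v) − 𝒯 a‖ ≤ 2B∕R`) and
  `norm_mixedDiff_le_of_differentiableOn_affine` (`a + z•v₁ + w•v₂ ∈ D` on the bidisc ⟹ `‖𝒯(a+v₁+v₂) − 𝒯(a+v₁) − 𝒯(a+v₂) + 𝒯 a‖ ≤ 4B∕(R₁R₂)`);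
* §3 ★★★ the BALL editions = the row's moduli READ OFF a bounded analytic extension to a `ρ`-neighbourhood: `Metric.ball a ρ ⊆ D` ⟹
  `norm_sub_le_of_ball_subset` (`‖𝒯(a+v) − 𝒯 a‖ ≤ (2B∕ρ)·‖v‖` for `‖v‖ < ρ` — LIPSCHITZ modulus `ℓ = 2B∕ρ`), `norm_mixedDiff_le_of_ball_subset`
  (`‖𝒯(a+v₁+v₂) − 𝒯(a+v₁) − 𝒯(a+v₂) + 𝒯 a‖ ≤ (16B∕ρ²)·‖v₁‖·‖v₂‖` for `‖vᵢ‖ < ρ∕2` — C¹·¹ modulus `h = 16B∕ρ²`, the PRODUCT shape of (f)), and the four-corner form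
  `norm_c11_of_ball_subset` with exactly the row's `hC11` right-hand side `h·‖u₁₀−u₀₀‖·‖u₀₁−u₀₀‖ + ℓ′·‖u₁₁−u₁₀−u₀₁+u₀₀‖` (`ℓ′ = 4B∕ρ`) for corners in
  `ball u₀₀ (ρ∕8)`; `abs_re_mixedDiff_le` passes to real parts (the row's terms are real; first order = lit ✓`Percolation.abs_re_sub_le_norm_sub`).
* §5 ★★★ the DOCKING editions in the currency of LEAD w3-20520 g20's ✓`…BackgroundFormAlgebra` (his ask): a LOCAL term given through the restriction to its support
  `S` by `𝒯 : (S → W) → ℂ` complex-differentiable and bounded by `B` on `D ⊇ ball (u₀₀|_S) ρ` satisfies `lip_of_local_analytic` = the `hlip` binder shape of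
  ✓`oneBond_le_of_sensitivity` (`ℓ X := 2B∕ρ`, Σ-norm moves `< ρ`) and `c11_of_local_analytic` = the `hC11` binder shape of ✓`fourPoint_le_of_sensitivity`
  (`h X := 16B∕ρ²`, `ℓ X := 4B∕ρ`, Σ-moves `< ρ∕8`), LITERALLY (same corner order, same association), via `pi_norm_restrict_le_sum` (sup norm ≤ Σ-norm).
USE.  An ANALYTIC EDITION «BGFORMᵃ∘ → BGFORM∘» (the g24-4 analogue of LEAD's ✓(D) `…PolymerAnalyticKnit` for g24-3) calls §3 with `V := X → Fin 8 → ℂ` (sup norm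
`≤` the row's Σ-norm): a bounded analytic extension of each term to a complex `ρ`-neighbourhood of the background window gives BOTH moduli with `h ∝ ρ⁻²`, and the
same lemma at the background map's two-parameter family gives the product-kernel response — nothing else is used.  The row-level edition (domain shape in print's
gauge, real ↔ complex coordinates) is not typed here.

HONEST SCOPE.  Schwarz lemma ×2 + affine composition + triangle inequality; nothing of Bałaban's analyticity domains or bounds is asserted or proved; BGFORM∘ ∕ its
analytic edition ∕ S2β ∕ GRAD∘ ∕ the five registered ∘-stubs ∕ `FluctuationComparisonRegPrIntL` (20520) NOT proved; no summit is proved by a helper; rung R3 = SU(2)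
YM₃ on T³ — NOT d = 4, NOT infinite volume, NOT a mass gap, NOT Clay.  Sorry-free, axioms standard.

References: T. Bałaban, CMP **109** (1987) 249–301 [Balaban1987RG1] ((0.25) p.257; (1.11)–(1.14) p.262; Thm 1 p.259); CMP **102** (1985) 277–309
[Balaban1985Variational] (Sect. G p.305, Prop. 9 p.309, (182)–(190) pp.307–308); CMP **122** (1989) 355–392 [Balaban1989LargeFieldII] ((1.98)–(1.100) p.390).
-/

set_option autoImplicit false

noncomputable section

namespace Summit.QuantumFields.YangMills.Theorems.FluctuationComparisonRegPrIntLBackgroundFormCauchyShape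

open Set Metric

/-! ## §1 The two-parameter Schwarz corollary -/

/-- The one-variable Schwarz step used throughout (kept as a local statement over an arbitrary function to avoid restating LEAD's
✓`…PolymerAnalyticKnit.norm_sub_le_of_differentiableOn_ball` as a declaration with the same text): `f` differentiable on `ball 0 R`, `1 < R`, `‖f z‖ ≤ B′` there
⟹ `‖f 1 − f 0‖ ≤ 2B′∕R`, by `Complex.dist_le_div_mul_dist_of_mapsTo_ball`. [cite: Balaban1987RG1, (1.11)-(1.14) p.262] -/
theorem norm_sub_le_two_mul_div_of_differentiableOn {f : ℂ → ℂ} {R B' : ℝ} (hR : 1 < R) (hf : DifferentiableOn ℂ f (ball 0 R))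
    (hB' : ∀ z ∈ ball (0 : ℂ) R, ‖f z‖ ≤ B') (z : ℂ) (hz : z ∈ ball (0 : ℂ) R) : ‖f z - f 0‖ ≤ 2 * B' / R * ‖z‖ := by
  have h0 : (0 : ℂ) ∈ ball (0 : ℂ) R := mem_ball_self (by linarith)
  have hmaps : MapsTo f (ball (0 : ℂ) R) (closedBall (f 0) (2 * B')) := by
    intro y hy
    rw [mem_closedBall, dist_eq_norm]
    calc ‖f y - f 0‖ ≤ ‖f y‖ + ‖f 0‖ := norm_sub_le _ _
      _ ≤ B' + B' := add_le_add (hB' y hy) (hB' 0 h0)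
      _ = 2 * B' := by ring
  have h := Complex.dist_le_div_mul_dist_of_mapsTo_ball hf hmaps hz
  rw [dist_eq_norm, dist_zero_right] at h
  exact h

/-- ★ **THE TWO-PARAMETER SCHWARZ COROLLARY.**  Let `g : ℂ → ℂ → ℂ`, `1 < R₁`, `1 < R₂`, `‖g z w‖ ≤ B` for `z ∈ ball 0 R₁`, `w ∈ ball 0 R₂`; assume the two
slices `z ↦ g z 0`, `z ↦ g z 1` are complex-differentiable on `ball 0 R₁` and every slice `w ↦ g z w` (`z ∈ ball 0 R₁`) is complex-differentiable on `ball 0 R₂`.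
Then the MIXED SECOND DIFFERENCE obeys `‖g 1 1 − g 1 0 − g 0 1 + g 0 0‖ ≤ 4·B ∕ (R₁·R₂)`: Schwarz in `w` on each slice (`‖g z 1 − g z 0‖ ≤ 2B∕R₂` on `ball 0 R₁`),
then Schwarz in `z` on the difference of the two slices.  This is the Cauchy-estimate SHAPE `1∕(R₁R₂)` of the product-kernel mixed-response clause and of the
discrete-C¹·¹ clause of the background form (card WHY-FAIL (f), (c)). [cite: Balaban1987RG1, (1.11)-(1.14) p.262 and (0.25) p.257; Balaban1985Variational, Prop. 9 p.309] -/
theorem norm_mixedDiff_le_of_differentiableOn_ball₂ {g : ℂ → ℂ → ℂ} {R₁ R₂ B : ℝ} (hR₁ : 1 < R₁) (hR₂ : 1 < R₂)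
    (hg0 : DifferentiableOn ℂ (fun z => g z 0) (ball 0 R₁)) (hg1 : DifferentiableOn ℂ (fun z => g z 1) (ball 0 R₁))
    (hgw : ∀ z ∈ ball (0 : ℂ) R₁, DifferentiableOn ℂ (g z) (ball 0 R₂))
    (hB : ∀ z ∈ ball (0 : ℂ) R₁, ∀ w ∈ ball (0 : ℂ) R₂, ‖g z w‖ ≤ B) :
    ‖g 1 1 - g 1 0 - g 0 1 + g 0 0‖ ≤ 4 * B / (R₁ * R₂) := by
  have h1₁ : (1 : ℂ) ∈ ball (0 : ℂ) R₁ := by rw [mem_ball, dist_zero_right, norm_one]; exact hR₁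
  have h1₂ : (1 : ℂ) ∈ ball (0 : ℂ) R₂ := by rw [mem_ball, dist_zero_right, norm_one]; exact hR₂
  -- Schwarz in `w` on each slice
  have hslice : ∀ z ∈ ball (0 : ℂ) R₁, ‖g z 1 - g z 0‖ ≤ 2 * B / R₂ := by
    intro z hz
    have := norm_sub_le_two_mul_div_of_differentiableOn hR₂ (hgw z hz) (fun w hw => hB z hz w hw) 1 h1₂
    simpa using this
  -- Schwarz in `z` on the difference of the slices
  have hdiff : DifferentiableOn ℂ (fun z => g z 1 - g z 0) (ball 0 R₁) := hg1.sub hg0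
  have key := norm_sub_le_two_mul_div_of_differentiableOn hR₁ hdiff hslice 1 h1₁
  have hrw : g 1 1 - g 1 0 - g 0 1 + g 0 0 = (g 1 1 - g 1 0) - (g 0 1 - g 0 0) := by ring
  rw [hrw]
  simp only [norm_one, mul_one] at key
  refine key.trans (le_of_eq ?_)
  have hR₁0 : R₁ ≠ 0 := by positivity
  have hR₂0 : R₂ ≠ 0 := by positivity
  field_simp
  ring

/-- The symmetric form of §1: all slices differentiable (in `z` for every `w ∈ ball 0 R₂`, in `w` for every `z ∈ ball 0 R₁`).
[cite: Balaban1987RG1, (1.11)-(1.14) p.262; Balaban1985Variational, Prop. 9 p.309] -/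
theorem norm_mixedDiff_le_of_differentiableOn_ball₂' {g : ℂ → ℂ → ℂ} {R₁ R₂ B : ℝ} (hR₁ : 1 < R₁) (hR₂ : 1 < R₂)
    (hgz : ∀ w ∈ ball (0 : ℂ) R₂, DifferentiableOn ℂ (fun z => g z w) (ball 0 R₁))
    (hgw : ∀ z ∈ ball (0 : ℂ) R₁, DifferentiableOn ℂ (g z) (ball 0 R₂))
    (hB : ∀ z ∈ ball (0 : ℂ) R₁, ∀ w ∈ ball (0 : ℂ) R₂, ‖g z w‖ ≤ B) :
    ‖g 1 1 - g 1 0 - g 0 1 + g 0 0‖ ≤ 4 * B / (R₁ * R₂) := by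
  have h0₂ : (0 : ℂ) ∈ ball (0 : ℂ) R₂ := mem_ball_self (by linarith)
  have h1₂ : (1 : ℂ) ∈ ball (0 : ℂ) R₂ := by rw [mem_ball, dist_zero_right, norm_one]; exact hR₂
  exact norm_mixedDiff_le_of_differentiableOn_ball₂ hR₁ hR₂ (hgz 0 h0₂) (hgz 1 h1₂) hgw hB

/-- The bound `B` is nonnegative as soon as `D` contains a point. [cite: Balaban1987RG1, (0.25) p.257] -/
theorem bound_nonneg_of_mem {V : Type*} {𝒯 : V → ℂ} {D : Set V} {B : ℝ} (hB : ∀ p ∈ D, ‖𝒯 p‖ ≤ B) {a : V} (ha : a ∈ D) :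
    0 ≤ B := (norm_nonneg _).trans (hB a ha)

/-! ## §2 The affine editions on a complex normed space -/

section Affine

variable {V : Type*} [NormedAddCommGroup V] [NormedSpace ℂ V] {𝒯 : V → ℂ} {D : Set V} {B : ℝ}

/-- The complex line `z ↦ a + z • v` is entire. [cite: Balaban1987RG1, (1.11)-(1.14) p.262] -/
theorem differentiable_affine_line (a v : V) : Differentiable ℂ (fun z : ℂ => a + z • v) :=
  (differentiable_id.smul_const v).const_add a

/-- ★★ **FIRST ORDER, AFFINE.**  If `𝒯` is complex-differentiable on `D`, `‖𝒯‖ ≤ B` on `D`, and the complex segment `a + z • v`, `‖z‖ < R` (`1 < R`) lies in `D`,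
then `‖𝒯 (a + v) − 𝒯 a‖ ≤ 2B∕R`. [cite: Balaban1987RG1, (0.25) p.257 and (1.11)-(1.14) p.262] -/
theorem norm_sub_le_of_differentiableOn_affine (h𝒯 : DifferentiableOn ℂ 𝒯 D) (hB : ∀ p ∈ D, ‖𝒯 p‖ ≤ B)
    (a v : V) {R : ℝ} (hR : 1 < R) (hD : ∀ z : ℂ, ‖z‖ < R → a + z • v ∈ D) :
    ‖𝒯 (a + v) - 𝒯 a‖ ≤ 2 * B / R := by
  set g : ℂ → ℂ := fun z => 𝒯 (a + z • v) with hg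
  have hmaps : MapsTo (fun z : ℂ => a + z • v) (ball (0 : ℂ) R) D := fun z hz => hD z (mem_ball_zero_iff.mp hz)
  have hgd : DifferentiableOn ℂ g (ball 0 R) := h𝒯.comp (differentiable_affine_line a v).differentiableOn hmaps
  have hgB : ∀ z ∈ ball (0 : ℂ) R, ‖g z‖ ≤ B := fun z hz => hB _ (hmaps hz)
  have h1 : (1 : ℂ) ∈ ball (0 : ℂ) R := by rw [mem_ball, dist_zero_right, norm_one]; exact hR
  have key := norm_sub_le_two_mul_div_of_differentiableOn hR hgd hgB 1 h1
  simpa [hg] using key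

/-- ★★ **MIXED SECOND ORDER, AFFINE.**  If `𝒯` is complex-differentiable on `D`, `‖𝒯‖ ≤ B` on `D`, and the complex parallelogram `a + z • v₁ + w • v₂`,
`‖z‖ < R₁`, `‖w‖ < R₂` (`1 < Rᵢ`) lies in `D`, then `‖𝒯 (a + v₁ + v₂) − 𝒯 (a + v₁) − 𝒯 (a + v₂) + 𝒯 a‖ ≤ 4B∕(R₁R₂)` (§1 on `g z w := 𝒯 (a + z•v₁ + w•v₂)`).
[cite: Balaban1987RG1, (0.25) p.257 and (1.11)-(1.14) p.262; Balaban1985Variational, Prop. 9 p.309] -/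
theorem norm_mixedDiff_le_of_differentiableOn_affine (h𝒯 : DifferentiableOn ℂ 𝒯 D) (hB : ∀ p ∈ D, ‖𝒯 p‖ ≤ B)
    (a v₁ v₂ : V) {R₁ R₂ : ℝ} (hR₁ : 1 < R₁) (hR₂ : 1 < R₂)
    (hD : ∀ z w : ℂ, ‖z‖ < R₁ → ‖w‖ < R₂ → a + z • v₁ + w • v₂ ∈ D) :
    ‖𝒯 (a + v₁ + v₂) - 𝒯 (a + v₁) - 𝒯 (a + v₂) + 𝒯 a‖ ≤ 4 * B / (R₁ * R₂) := by
  set g : ℂ → ℂ → ℂ := fun z w => 𝒯 (a + z • v₁ + w • v₂) with hg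
  have hgz : ∀ w ∈ ball (0 : ℂ) R₂, DifferentiableOn ℂ (fun z => g z w) (ball 0 R₁) := by
    intro w hw
    have hmaps : MapsTo (fun z : ℂ => (a + w • v₂) + z • v₁) (ball (0 : ℂ) R₁) D := by
      intro z hz
      have := hD z w (mem_ball_zero_iff.mp hz) (mem_ball_zero_iff.mp hw)
      have hrw : (a + w • v₂) + z • v₁ = a + z • v₁ + w • v₂ := by abel
      change a + w • v₂ + z • v₁ ∈ D
      rw [hrw]; exact this
    have hcomp := h𝒯.comp (differentiable_affine_line (a + w • v₂) v₁).differentiableOn hmaps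
    refine hcomp.congr (fun z _ => ?_)
    simp only [hg, Function.comp]
    congr 1; abel
  have hgw : ∀ z ∈ ball (0 : ℂ) R₁, DifferentiableOn ℂ (g z) (ball 0 R₂) := by
    intro z hz
    have hmaps : MapsTo (fun w : ℂ => (a + z • v₁) + w • v₂) (ball (0 : ℂ) R₂) D :=
      fun w hw => hD z w (mem_ball_zero_iff.mp hz) (mem_ball_zero_iff.mp hw)
    exact h𝒯.comp (differentiable_affine_line (a + z • v₁) v₂).differentiableOn hmaps
  have hgB : ∀ z ∈ ball (0 : ℂ) R₁, ∀ w ∈ ball (0 : ℂ) R₂, ‖g z w‖ ≤ B :=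
    fun z hz w hw => hB _ (hD z w (mem_ball_zero_iff.mp hz) (mem_ball_zero_iff.mp hw))
  have key := norm_mixedDiff_le_of_differentiableOn_ball₂' hR₁ hR₂ hgz hgw hgB
  simpa [hg] using key

end Affine

/-! ## §3 The ball editions: the Lipschitz modulus `2B∕ρ`, the C¹·¹ modulus `16B∕ρ²`, and the four-corner `hC11` form -/

section Ball

variable {V : Type*} [NormedAddCommGroup V] [NormedSpace ℂ V] {𝒯 : V → ℂ} {D : Set V} {B : ℝ}

/-- ★★★ **LIPSCHITZ MODULUS FROM A BOUNDED ANALYTIC EXTENSION.**  If `𝒯` is complex-differentiable on `D ⊇ ball a ρ` with `‖𝒯‖ ≤ B` on `D`, then for every move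
`‖v‖ < ρ`: `‖𝒯 (a + v) − 𝒯 a‖ ≤ (2B∕ρ)·‖v‖` — the row's Lipschitz modulus `ℓ = 2B∕ρ` (card WHY-FAIL (c): «(0.25) + analyticity + Cauchy»).
[cite: Balaban1987RG1, (0.25) p.257 and (1.11)-(1.14) p.262] -/
theorem norm_sub_le_of_ball_subset (h𝒯 : DifferentiableOn ℂ 𝒯 D) (hB : ∀ p ∈ D, ‖𝒯 p‖ ≤ B)
    {a : V} {ρ : ℝ} (hρ : 0 < ρ) (hball : ball a ρ ⊆ D) (v : V) (hv : ‖v‖ < ρ) :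
    ‖𝒯 (a + v) - 𝒯 a‖ ≤ 2 * B / ρ * ‖v‖ := by
  have hB0 : 0 ≤ B := bound_nonneg_of_mem hB (hball (mem_ball_self hρ))
  by_cases hv0 : v = 0
  · subst hv0
    simp only [add_zero, sub_self, norm_zero, mul_zero, le_refl]
  have hvpos : 0 < ‖v‖ := norm_pos_iff.mpr hv0
  set R : ℝ := ρ / ‖v‖ with hR
  have hR1 : 1 < R := by rw [hR, lt_div_iff₀ hvpos]; linarith
  have hD : ∀ z : ℂ, ‖z‖ < R → a + z • v ∈ D := by
    intro z hz
    refine hball ?_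
    rw [mem_ball, dist_eq_norm, add_sub_cancel_left, norm_smul]
    calc ‖z‖ * ‖v‖ < R * ‖v‖ := mul_lt_mul_of_pos_right hz hvpos
      _ = ρ := by rw [hR]; field_simp
  have key := norm_sub_le_of_differentiableOn_affine h𝒯 hB a v hR1 hD
  refine key.trans (le_of_eq ?_)
  rw [hR]
  field_simp

/-- ★★★ **C¹·¹ MODULUS FROM A BOUNDED ANALYTIC EXTENSION — THE PRODUCT SHAPE.**  If `𝒯` is complex-differentiable on `D ⊇ ball a ρ` with `‖𝒯‖ ≤ B` on `D`, then
for moves `‖v₁‖, ‖v₂‖ < ρ∕2`: `‖𝒯 (a + v₁ + v₂) − 𝒯 (a + v₁) − 𝒯 (a + v₂) + 𝒯 a‖ ≤ (16B∕ρ²)·‖v₁‖·‖v₂‖` — the row's discrete-C¹·¹ modulus `h = 16B∕ρ²`, BILINEAR in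
the two move sizes (card WHY-FAIL (f): the product-kernel shape IS the Cauchy shape). [cite: Balaban1987RG1, (0.25) p.257 and (1.11)-(1.14) p.262; Balaban1985Variational, Prop. 9 p.309 and (190) p.308] -/
theorem norm_mixedDiff_le_of_ball_subset (h𝒯 : DifferentiableOn ℂ 𝒯 D) (hB : ∀ p ∈ D, ‖𝒯 p‖ ≤ B)
    {a : V} {ρ : ℝ} (hρ : 0 < ρ) (hball : ball a ρ ⊆ D) (v₁ v₂ : V) (hv₁ : ‖v₁‖ < ρ / 2) (hv₂ : ‖v₂‖ < ρ / 2) :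
    ‖𝒯 (a + v₁ + v₂) - 𝒯 (a + v₁) - 𝒯 (a + v₂) + 𝒯 a‖ ≤ 16 * B / ρ ^ 2 * (‖v₁‖ * ‖v₂‖) := by
  have hB0 : 0 ≤ B := bound_nonneg_of_mem hB (hball (mem_ball_self hρ))
  have hrhs : 0 ≤ 16 * B / ρ ^ 2 * (‖v₁‖ * ‖v₂‖) := by positivity
  by_cases hv₁0 : v₁ = 0
  · subst hv₁0
    have : 𝒯 (a + 0 + v₂) - 𝒯 (a + 0) - 𝒯 (a + v₂) + 𝒯 a = 0 := by simp only [add_zero]; ring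
    rw [this, norm_zero]; exact hrhs
  by_cases hv₂0 : v₂ = 0
  · subst hv₂0
    have : 𝒯 (a + v₁ + 0) - 𝒯 (a + v₁) - 𝒯 (a + 0) + 𝒯 a = 0 := by simp only [add_zero]; ring
    rw [this, norm_zero]; exact hrhs
  have h₁pos : 0 < ‖v₁‖ := norm_pos_iff.mpr hv₁0
  have h₂pos : 0 < ‖v₂‖ := norm_pos_iff.mpr hv₂0
  set R₁ : ℝ := ρ / (2 * ‖v₁‖) with hR₁
  set R₂ : ℝ := ρ / (2 * ‖v₂‖) with hR₂
  have hR₁1 : 1 < R₁ := by rw [hR₁, lt_div_iff₀ (by positivity)]; linarith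
  have hR₂1 : 1 < R₂ := by rw [hR₂, lt_div_iff₀ (by positivity)]; linarith
  have hD : ∀ z w : ℂ, ‖z‖ < R₁ → ‖w‖ < R₂ → a + z • v₁ + w • v₂ ∈ D := by
    intro z w hz hw
    refine hball ?_
    rw [mem_ball, dist_eq_norm]
    have hrw : a + z • v₁ + w • v₂ - a = z • v₁ + w • v₂ := by abel
    rw [hrw]
    have hz' : ‖z • v₁‖ < ρ / 2 := by
      rw [norm_smul]
      calc ‖z‖ * ‖v₁‖ < R₁ * ‖v₁‖ := mul_lt_mul_of_pos_right hz h₁pos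
        _ = ρ / 2 := by rw [hR₁]; field_simp
    have hw' : ‖w • v₂‖ < ρ / 2 := by
      rw [norm_smul]
      calc ‖w‖ * ‖v₂‖ < R₂ * ‖v₂‖ := mul_lt_mul_of_pos_right hw h₂pos
        _ = ρ / 2 := by rw [hR₂]; field_simp
    calc ‖z • v₁ + w • v₂‖ ≤ ‖z • v₁‖ + ‖w • v₂‖ := norm_add_le _ _
      _ < ρ / 2 + ρ / 2 := add_lt_add hz' hw'
      _ = ρ := by ring
  have key := norm_mixedDiff_le_of_differentiableOn_affine h𝒯 hB a v₁ v₂ hR₁1 hR₂1 hD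
  refine key.trans (le_of_eq ?_)
  rw [hR₁, hR₂]
  field_simp
  ring

/-- ★★★ **THE FOUR-CORNER `hC11` FORM.**  If `𝒯` is complex-differentiable on `D ⊇ ball u₀₀ ρ` with `‖𝒯‖ ≤ B` on `D`, then for corners `u₁₀, u₀₁, u₁₁ ∈ ball u₀₀ (ρ∕8)`:
`‖𝒯 u₁₁ − 𝒯 u₁₀ − 𝒯 u₀₁ + 𝒯 u₀₀‖ ≤ (16B∕ρ²)·‖u₁₀ − u₀₀‖·‖u₀₁ − u₀₀‖ + (4B∕ρ)·‖u₁₁ − u₁₀ − u₀₁ + u₀₀‖` — exactly the right-hand side of the row's C¹·¹ clause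
(`h := 16B∕ρ²` on the product of the two first-order moves, `ℓ′ := 4B∕ρ` on the second difference of the corners, which vanishes for a parallelogram): the mixed
part at the parallelogram corner `u₁₀ + u₀₁ − u₀₀` by `norm_mixedDiff_le_of_ball_subset`, the defect `u₁₁ − (u₁₀ + u₀₁ − u₀₀)` by the Lipschitz modulus on
`ball (u₁₀ + u₀₁ − u₀₀) (ρ∕2) ⊆ ball u₀₀ ρ`. [cite: Balaban1987RG1, (0.25) p.257 and (1.11)-(1.14) p.262; Balaban1985Variational, Prop. 9 p.309 and (190) p.308] -/
theorem norm_c11_of_ball_subset (h𝒯 : DifferentiableOn ℂ 𝒯 D) (hB : ∀ p ∈ D, ‖𝒯 p‖ ≤ B)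
    {u₀₀ : V} {ρ : ℝ} (hρ : 0 < ρ) (hball : ball u₀₀ ρ ⊆ D) (u₁₀ u₀₁ u₁₁ : V)
    (h₁₀ : ‖u₁₀ - u₀₀‖ < ρ / 8) (h₀₁ : ‖u₀₁ - u₀₀‖ < ρ / 8) (h₁₁ : ‖u₁₁ - u₀₀‖ < ρ / 8) :
    ‖𝒯 u₁₁ - 𝒯 u₁₀ - 𝒯 u₀₁ + 𝒯 u₀₀‖ ≤
      16 * B / ρ ^ 2 * (‖u₁₀ - u₀₀‖ * ‖u₀₁ - u₀₀‖) + 4 * B / ρ * ‖u₁₁ - u₁₀ - u₀₁ + u₀₀‖ := by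
  set v₁ : V := u₁₀ - u₀₀ with hv₁
  set v₂ : V := u₀₁ - u₀₀ with hv₂
  set P : V := u₀₀ + v₁ + v₂ with hP
  -- the mixed part at the parallelogram corner
  have hmix := norm_mixedDiff_le_of_ball_subset h𝒯 hB hρ hball v₁ v₂ (by linarith) (by linarith)
  have hc₁ : u₀₀ + v₁ = u₁₀ := by rw [hv₁]; abel
  have hc₂ : u₀₀ + v₂ = u₀₁ := by rw [hv₂]; abel
  rw [← hP, hc₁, hc₂] at hmix
  -- the Lipschitz defect from the parallelogram corner `P` to `u₁₁`
  have hPball : ball P (ρ / 2) ⊆ D := by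
    refine Subset.trans ?_ hball
    intro x hx
    rw [mem_ball, dist_eq_norm] at hx ⊢
    have hPu : ‖P - u₀₀‖ < ρ / 4 := by
      have hrw : P - u₀₀ = v₁ + v₂ := by rw [hP]; abel
      rw [hrw]
      calc ‖v₁ + v₂‖ ≤ ‖v₁‖ + ‖v₂‖ := norm_add_le _ _
        _ < ρ / 8 + ρ / 8 := add_lt_add h₁₀ h₀₁
        _ = ρ / 4 := by ring
    calc ‖x - u₀₀‖ = ‖(x - P) + (P - u₀₀)‖ := by congr 1; abel
      _ ≤ ‖x - P‖ + ‖P - u₀₀‖ := norm_add_le _ _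
      _ < ρ / 2 + ρ / 4 := add_lt_add hx hPu
      _ ≤ ρ := by linarith
  set w : V := u₁₁ - P with hw
  have hwn : ‖w‖ < ρ / 2 := by
    have hrw : w = (u₁₁ - u₀₀) - v₁ - v₂ := by rw [hw, hP]; abel
    rw [hrw]
    calc ‖u₁₁ - u₀₀ - v₁ - v₂‖ ≤ ‖u₁₁ - u₀₀ - v₁‖ + ‖v₂‖ := norm_sub_le _ _
      _ ≤ ‖u₁₁ - u₀₀‖ + ‖v₁‖ + ‖v₂‖ := by linarith [norm_sub_le (u₁₁ - u₀₀) v₁]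
      _ < ρ / 8 + ρ / 8 + ρ / 8 := by linarith
      _ ≤ ρ / 2 := by linarith
  have hlip := norm_sub_le_of_ball_subset h𝒯 hB (by linarith : 0 < ρ / 2) hPball w hwn
  have hPw : P + w = u₁₁ := by rw [hw]; abel
  rw [hPw] at hlip
  have hwdef : w = u₁₁ - u₁₀ - u₀₁ + u₀₀ := by rw [hw, hP, hv₁, hv₂]; abel
  -- assemble
  have hsplit : 𝒯 u₁₁ - 𝒯 u₁₀ - 𝒯 u₀₁ + 𝒯 u₀₀ = (𝒯 u₁₁ - 𝒯 P) + (𝒯 P - 𝒯 u₁₀ - 𝒯 u₀₁ + 𝒯 u₀₀) := by ring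
  rw [hsplit]
  refine (norm_add_le _ _).trans ?_
  rw [add_comm]
  refine add_le_add hmix ?_
  calc ‖𝒯 u₁₁ - 𝒯 P‖ ≤ 2 * B / (ρ / 2) * ‖w‖ := hlip
    _ = 4 * B / ρ * ‖u₁₁ - u₁₀ - u₀₁ + u₀₀‖ := by rw [hwdef]; field_simp; ring

end Ball

/-! ## §4 Passing to real parts (the row's terms are real-valued; the first-order form `|Re p − Re q| ≤ ‖p − q‖` is already in the tree as
✓`Literature.Probability.Percolation.abs_re_sub_le_norm_sub` — import `Literature.Probability.Percolation.CrossingChains` for it) -/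

/-- `|Re p₁₁ − Re p₁₀ − Re p₀₁ + Re p₀₀| ≤ ‖p₁₁ − p₁₀ − p₀₁ + p₀₀‖`. [cite: Balaban1987RG1, (0.25) p.257] -/
theorem abs_re_mixedDiff_le (p₁₁ p₁₀ p₀₁ p₀₀ : ℂ) :
    |p₁₁.re - p₁₀.re - p₀₁.re + p₀₀.re| ≤ ‖p₁₁ - p₁₀ - p₀₁ + p₀₀‖ := by
  have : p₁₁.re - p₁₀.re - p₀₁.re + p₀₀.re = (p₁₁ - p₁₀ - p₀₁ + p₀₀).re := by
    simp only [Complex.sub_re, Complex.add_re]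
  rw [this]; exact Complex.abs_re_le_norm _

/-! ## §5 DOCKING EDITIONS in the currency of ✓`…BackgroundFormAlgebra` (LEAD w3-20520 g20's ask 13:35:16Z): local terms through the restriction to their
support `S`, moves measured by the Σ-norm `Σ_{e∈S} ‖u e − u′ e‖` of the row, conclusions = the `hlip` ∕ `hC11` binder shapes of ✓`oneBond_le_of_sensitivity` ∕
✓`fourPoint_le_of_sensitivity` with `ℓ := 2B∕ρ` (resp. `4B∕ρ`) and `h := 16B∕ρ²` -/

section Docking

variable {E W : Type*} [NormedAddCommGroup W] [NormedSpace ℂ W]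

omit [NormedSpace ℂ W] in
/-- The sup norm of a restricted configuration is at most the Σ-norm over the support. [cite: Balaban1987RG1, (0.25) p.257] -/
theorem pi_norm_restrict_le_sum (S : Finset E) (f : E → W) : ‖(fun e : ↥S => f e)‖ ≤ ∑ e ∈ S, ‖f e‖ := by
  refine (pi_norm_le_iff_of_nonneg (Finset.sum_nonneg fun e _ => norm_nonneg _)).mpr ?_
  intro e
  exact Finset.single_le_sum (f := fun e => ‖f e‖) (fun _ _ => norm_nonneg _) e.2

/-- ★★★ **THE `hlip` SHAPE.**  A term given through the restriction to its support `S` by a function `𝒯` complex-differentiable on `D ⊇ ball (u′|_S) ρ` with `‖𝒯‖ ≤ B`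
on `D` is LIPSCHITZ in the Σ-norm of the row for moves `< ρ`: `|Re 𝒯(u|_S) − Re 𝒯(u′|_S)| ≤ (2B∕ρ) · Σ_{e∈S} ‖u e − u′ e‖` — the `hlip` binder of
✓`…BackgroundFormAlgebra.oneBond_le_of_sensitivity` with `ℓ X := 2B∕ρ`. [cite: Balaban1987RG1, (0.25) p.257 and (1.11)-(1.14) p.262] -/
theorem lip_of_local_analytic (S : Finset E) {𝒯 : (↥S → W) → ℂ} {D : Set (↥S → W)} {B ρ : ℝ}
    (h𝒯 : DifferentiableOn ℂ 𝒯 D) (hB : ∀ p ∈ D, ‖𝒯 p‖ ≤ B) (hρ : 0 < ρ)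
    (u u' : E → W) (hball : ball (fun e : ↥S => u' e) ρ ⊆ D) (hmove : ∑ e ∈ S, ‖u e - u' e‖ < ρ) :
    |(𝒯 (fun e : ↥S => u e)).re - (𝒯 (fun e : ↥S => u' e)).re| ≤ 2 * B / ρ * ∑ e ∈ S, ‖u e - u' e‖ := by
  have hB0 : 0 ≤ B := bound_nonneg_of_mem hB (hball (mem_ball_self hρ))
  set v : ↥S → W := fun e => u e - u' e with hv
  have hvn : ‖v‖ ≤ ∑ e ∈ S, ‖u e - u' e‖ := pi_norm_restrict_le_sum S (fun e => u e - u' e)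
  have hvρ : ‖v‖ < ρ := lt_of_le_of_lt hvn hmove
  have key := norm_sub_le_of_ball_subset h𝒯 hB hρ hball v hvρ
  have hadd : (fun e : ↥S => u' e) + v = fun e : ↥S => u e := by
    funext e; simp [hv]
  rw [hadd] at key
  calc |(𝒯 (fun e : ↥S => u e)).re - (𝒯 (fun e : ↥S => u' e)).re|
      = |(𝒯 (fun e : ↥S => u e) - 𝒯 (fun e : ↥S => u' e)).re| := by rw [Complex.sub_re]
    _ ≤ ‖𝒯 (fun e : ↥S => u e) - 𝒯 (fun e : ↥S => u' e)‖ := Complex.abs_re_le_norm _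
    _ ≤ 2 * B / ρ * ‖v‖ := key
    _ ≤ 2 * B / ρ * ∑ e ∈ S, ‖u e - u' e‖ := mul_le_mul_of_nonneg_left hvn (by positivity)

/-- ★★★ **THE `hC11` SHAPE.**  Same setting, four corners `u₀₀ u₁₀ u₀₁ u₁₁` whose Σ-moves from `u₀₀` on `S` are `< ρ∕8`, `D ⊇ ball (u₀₀|_S) ρ`:
`|Re 𝒯(u₁₁|_S) − Re 𝒯(u₁₀|_S) − Re 𝒯(u₀₁|_S) + Re 𝒯(u₀₀|_S)| ≤ (16B∕ρ²)·(Σ_{e∈S}‖u₁₀ e − u₀₀ e‖)·(Σ_{e∈S}‖u₀₁ e − u₀₀ e‖) + (4B∕ρ)·Σ_{e∈S}‖u₁₁ e − u₁₀ e − u₀₁ e + u₀₀ e‖`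
— LITERALLY the `hC11` binder of ✓`…BackgroundFormAlgebra.fourPoint_le_of_sensitivity` with `h X := 16B∕ρ²`, `ℓ X := 4B∕ρ` (same binder order `u₀₀ u₁₀ u₀₁ u₁₁`,
same association `h · Σ · Σ + ℓ · Σ`), so an analytic edition of BGFORM∘ docks by `exact`. [cite: Balaban1987RG1, (0.25) p.257 and (1.11)-(1.14) p.262; Balaban1985Variational, Prop. 9 p.309 and (190) p.308] -/
theorem c11_of_local_analytic (S : Finset E) {𝒯 : (↥S → W) → ℂ} {D : Set (↥S → W)} {B ρ : ℝ}
    (h𝒯 : DifferentiableOn ℂ 𝒯 D) (hB : ∀ p ∈ D, ‖𝒯 p‖ ≤ B) (hρ : 0 < ρ)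
    (u₀₀ u₁₀ u₀₁ u₁₁ : E → W) (hball : ball (fun e : ↥S => u₀₀ e) ρ ⊆ D)
    (h₁₀ : ∑ e ∈ S, ‖u₁₀ e - u₀₀ e‖ < ρ / 8) (h₀₁ : ∑ e ∈ S, ‖u₀₁ e - u₀₀ e‖ < ρ / 8)
    (h₁₁ : ∑ e ∈ S, ‖u₁₁ e - u₀₀ e‖ < ρ / 8) :
    |(𝒯 (fun e : ↥S => u₁₁ e)).re - (𝒯 (fun e : ↥S => u₁₀ e)).re - (𝒯 (fun e : ↥S => u₀₁ e)).re + (𝒯 (fun e : ↥S => u₀₀ e)).re| ≤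
      16 * B / ρ ^ 2 * (∑ e ∈ S, ‖u₁₀ e - u₀₀ e‖) * (∑ e ∈ S, ‖u₀₁ e - u₀₀ e‖) +
        4 * B / ρ * ∑ e ∈ S, ‖u₁₁ e - u₁₀ e - u₀₁ e + u₀₀ e‖ := by
  have hB0 : 0 ≤ B := bound_nonneg_of_mem hB (hball (mem_ball_self hρ))
  set r₀₀ : ↥S → W := fun e => u₀₀ e with hr₀₀
  set r₁₀ : ↥S → W := fun e => u₁₀ e with hr₁₀
  set r₀₁ : ↥S → W := fun e => u₀₁ e with hr₀₁
  set r₁₁ : ↥S → W := fun e => u₁₁ e with hr₁₁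
  have n₁₀ : ‖r₁₀ - r₀₀‖ ≤ ∑ e ∈ S, ‖u₁₀ e - u₀₀ e‖ := pi_norm_restrict_le_sum S (fun e => u₁₀ e - u₀₀ e)
  have n₀₁ : ‖r₀₁ - r₀₀‖ ≤ ∑ e ∈ S, ‖u₀₁ e - u₀₀ e‖ := pi_norm_restrict_le_sum S (fun e => u₀₁ e - u₀₀ e)
  have n₁₁ : ‖r₁₁ - r₀₀‖ ≤ ∑ e ∈ S, ‖u₁₁ e - u₀₀ e‖ := pi_norm_restrict_le_sum S (fun e => u₁₁ e - u₀₀ e)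
  have n₂ : ‖r₁₁ - r₁₀ - r₀₁ + r₀₀‖ ≤ ∑ e ∈ S, ‖u₁₁ e - u₁₀ e - u₀₁ e + u₀₀ e‖ :=
    pi_norm_restrict_le_sum S (fun e => u₁₁ e - u₁₀ e - u₀₁ e + u₀₀ e)
  have key := norm_c11_of_ball_subset h𝒯 hB hρ hball r₁₀ r₀₁ r₁₁ (lt_of_le_of_lt n₁₀ h₁₀) (lt_of_le_of_lt n₀₁ h₀₁) (lt_of_le_of_lt n₁₁ h₁₁)
  have hre : |(𝒯 r₁₁).re - (𝒯 r₁₀).re - (𝒯 r₀₁).re + (𝒯 r₀₀).re| ≤ ‖𝒯 r₁₁ - 𝒯 r₁₀ - 𝒯 r₀₁ + 𝒯 r₀₀‖ := abs_re_mixedDiff_le _ _ _ _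
  refine hre.trans (key.trans ?_)
  have hc₁ : 0 ≤ 16 * B / ρ ^ 2 := by positivity
  have hc₂ : 0 ≤ 4 * B / ρ := by positivity
  have hprod : ‖r₁₀ - r₀₀‖ * ‖r₀₁ - r₀₀‖ ≤ (∑ e ∈ S, ‖u₁₀ e - u₀₀ e‖) * (∑ e ∈ S, ‖u₀₁ e - u₀₀ e‖) :=
    mul_le_mul n₁₀ n₀₁ (norm_nonneg _) (Finset.sum_nonneg fun e _ => norm_nonneg _)
  calc 16 * B / ρ ^ 2 * (‖r₁₀ - r₀₀‖ * ‖r₀₁ - r₀₀‖) + 4 * B / ρ * ‖r₁₁ - r₁₀ - r₀₁ + r₀₀‖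
      ≤ 16 * B / ρ ^ 2 * ((∑ e ∈ S, ‖u₁₀ e - u₀₀ e‖) * (∑ e ∈ S, ‖u₀₁ e - u₀₀ e‖)) + 4 * B / ρ * ∑ e ∈ S, ‖u₁₁ e - u₁₀ e - u₀₁ e + u₀₀ e‖ :=
        add_le_add (mul_le_mul_of_nonneg_left hprod hc₁) (mul_le_mul_of_nonneg_left n₂ hc₂)
    _ = 16 * B / ρ ^ 2 * (∑ e ∈ S, ‖u₁₀ e - u₀₀ e‖) * (∑ e ∈ S, ‖u₀₁ e - u₀₀ e‖) +
        4 * B / ρ * ∑ e ∈ S, ‖u₁₁ e - u₁₀ e - u₀₁ e + u₀₀ e‖ := by ring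

end Docking

end Summit.QuantumFields.YangMills.Theorems.FluctuationComparisonRegPrIntLBackgroundFormCauchyShape
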